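import Mathlib
import Summits.ValiantsHypothesis.ValiantsHypothesis.Theorems.ProofCarryingSymmetryRestorationQPConstNormAC
import Summits.ValiantsHypothesis.ValiantsHypothesis.Theorems.ProofCarryingSymmetryRestorationQPDistOne

/-!
# Route ProofCarryingSymmetry — crux `RestorationQP`, line `registered`: every formula is congruent to its constant-folding normal form

Support file for the crux item `stmt-ValiantsHypothesis-10343` (lead c5, rung S3^(1)-inv, stub
`esat_ucEq_cnorm`).  The constant-folding normaliser `cnorm` of rung S3⁗
(`…RestorationQPConstNorm.lean`: the smart sum `sadd` and the smart product `smul`, bottom-up) only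
ever applies the axioms it is meant to absorb: `F = cnorm F` is DERIVABLE in the distributivity-free
fragment `UCEq` of Hrubeš–Tzameret's `P_f` (A1–A5, the unit laws A7–A9, the true constant equations
A10 and the rules R1–R4; `…RestorationQPDistEq.lean`), over any commutative semiring of constants:

* `ucEq_amk_asplit`, `ucEq_mmk_msplit` — a formula is congruent to the reassembly of its additive /
  multiplicative parts;
* `ucEq_add_amk`, `ucEq_mul_mmk` — a sum / product of reassembled parts is congruent to the
  reassembly of the merged parts;
* `ucEq_sadd`, `ucEq_smul`, **`ucEq_cnorm`** — `F + G ≡ sadd F G`, `F · G ≡ smul F G` and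
  `F ≡ cnorm F` modulo `UCEq`;
* `NF.cnorm_eq` — the normal forms of `…RestorationQPConstNormNF.lean` are fixed by `cnorm` (over
  constants with `0 ≠ 1`);

and the registered stub `esat_ucEq_cnorm` (over a field), which lets the e-saturation argument of
lead c5 replace the formulas `P, Q, R` of a ground distributivity instance by their normal forms.
Everything is elementary and proved; no named facts.
-/

-- single-problem summit: `Summit.ValiantsHypothesis.ValiantsHypothesis.…` is the namespace by design (D-0017)
set_option linter.dupNamespace false

noncomputable section

open scoped Classical

namespace Summit.ValiantsHypothesis.ValiantsHypothesis.Theorems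

namespace ACStability

open Literature.Computability.AlgebraicComplexity ACClass

universe u v

variable {𝔽 : Type u} {X : Type v}

section Semiring

variable [CommSemiring 𝔽]

/-! ### Rearrangements in the distributivity-free fragment -/

/-- `(p + a) + (q + b) ≡ (p + q) + (a + b)` (A2, A3). [folklore] -/
theorem UCEq.add_add_add_comm (p a q b : PIFormula 𝔽 X) :
    UCEq (.add (.add p a) (.add q b)) (.add (.add p q) (.add a b)) :=
  (UCEq.add_assoc p a (.add q b)).symm.trans <|
    (UCEq.add_congr (.refl p) <| (UCEq.add_assoc a q b).trans <|
      (UCEq.add_congr (UCEq.add_comm a q) (.refl b)).trans (UCEq.add_assoc q a b).symm).trans <|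
    UCEq.add_assoc p q (.add a b)

/-- `(p · a) · (q · b) ≡ (p · q) · (a · b)` (A4, A5). [folklore] -/
theorem UCEq.mul_mul_mul_comm (p a q b : PIFormula 𝔽 X) :
    UCEq (.mul (.mul p a) (.mul q b)) (.mul (.mul p q) (.mul a b)) :=
  (UCEq.mul_assoc p a (.mul q b)).symm.trans <|
    (UCEq.mul_congr (.refl p) <| (UCEq.mul_assoc a q b).trans <|
      (UCEq.mul_congr (UCEq.mul_comm a q) (.refl b)).trans (UCEq.mul_assoc q a b).symm).trans <|
    UCEq.mul_assoc p q (.mul a b)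

/-- `(p + c) + c' ≡ p + (c + c')`, the constants added (A3, A10). [folklore] -/
theorem ucEq_add_const_const (p : PIFormula 𝔽 X) (c c' : 𝔽) :
    UCEq (.add (.add p (.const c)) (.const c')) (.add p (.const (c + c'))) :=
  (UCEq.add_assoc p (.const c) (.const c')).symm.trans
    (UCEq.add_congr (.refl p) (UCEq.const_add (c + c') c c' rfl).symm)

/-- `(p · c) · c' ≡ p · (c c')`, the constants multiplied (A5, A10). [folklore] -/
theorem ucEq_mul_const_const (p : PIFormula 𝔽 X) (c c' : 𝔽) :
    UCEq (.mul (.mul p (.const c)) (.const c')) (.mul p (.const (c * c'))) :=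
  (UCEq.mul_assoc p (.const c) (.const c')).symm.trans
    (UCEq.mul_congr (.refl p) (UCEq.const_mul (c * c') c c' rfl).symm)

/-- `c + (q + c') ≡ q + (c + c')` (A2, A3, A10). [folklore] -/
theorem ucEq_const_add_add_const (q : PIFormula 𝔽 X) (c c' : 𝔽) :
    UCEq (.add (.const c) (.add q (.const c'))) (.add q (.const (c + c'))) :=
  (UCEq.add_comm _ _).trans <| (UCEq.add_assoc q (.const c') (.const c)).symm.trans
    (UCEq.add_congr (.refl q) (UCEq.const_add (c + c') c' c (add_comm c c')).symm)

/-- `c · (q · c') ≡ q · (c c')` (A4, A5, A10). [folklore] -/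
theorem ucEq_const_mul_mul_const (q : PIFormula 𝔽 X) (c c' : 𝔽) :
    UCEq (.mul (.const c) (.mul q (.const c'))) (.mul q (.const (c * c'))) :=
  (UCEq.mul_comm _ _).trans <| (UCEq.mul_assoc q (.const c') (.const c)).symm.trans
    (UCEq.mul_congr (.refl q) (UCEq.const_mul (c * c') c' c (mul_comm c c')).symm)

/-! ### Reassembling the parts -/

/-- `amk (some p) c ≡ p + c` (literally, or by A7 when `c = 0`). [folklore] -/
theorem ucEq_amk_some (p : PIFormula 𝔽 X) (c : 𝔽) : UCEq (amk (some p) c) (.add p (.const c)) := by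
  by_cases hc : c = 0
  · subst hc
    rw [amk_some_zero]
    exact (UCEq.add_zero p).symm
  · rw [amk_some_of_ne p hc]
    exact .refl _

/-- `mmk (some p) c ≡ p · c` (literally, or by A9 when `c = 1`). [folklore] -/
theorem ucEq_mmk_some (p : PIFormula 𝔽 X) (c : 𝔽) : UCEq (mmk (some p) c) (.mul p (.const c)) := by
  by_cases hc : c = 1
  · subst hc
    rw [mmk_some_one]
    exact (UCEq.mul_one p).symm
  · rw [mmk_some_of_ne p hc]
    exact .refl _

/-- `mmk m 0 ≡ 0` (A8). [folklore] -/
theorem ucEq_mmk_zero : ∀ m : Option (PIFormula 𝔽 X), UCEq (mmk m (0 : 𝔽)) (.const 0)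
  | none => .refl _
  | some p => (ucEq_mmk_some p 0).trans (UCEq.mul_zero p)

/-- **A formula is congruent to the reassembly of its additive parts.** [folklore] -/
theorem ucEq_amk_asplit (a : PIFormula 𝔽 X) : UCEq a (amk (asplit a).1 (asplit a).2) := by
  cases a with
  | var x =>
    simp only [asplit_var, amk_some_zero]
    exact .refl _
  | const c => exact .refl _
  | mul p q =>
    simp only [asplit_mul, amk_some_zero]
    exact .refl _
  | add p q =>
    cases hq : constOf q with
    | none =>
      simp only [asplit_add_of_ne hq, amk_some_zero]
      exact .refl _
    | some c =>
      obtain rfl := constOf_eq_some.1 hq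
      rw [asplit_add_const]
      exact (ucEq_amk_some p c).symm

/-- **A formula is congruent to the reassembly of its multiplicative parts.** [folklore] -/
theorem ucEq_mmk_msplit (a : PIFormula 𝔽 X) : UCEq a (mmk (msplit a).1 (msplit a).2) := by
  cases a with
  | var x =>
    simp only [msplit_var, mmk_some_one]
    exact .refl _
  | const c => exact .refl _
  | add p q =>
    simp only [msplit_add, mmk_some_one]
    exact .refl _
  | mul p q =>
    cases hq : constOf q with
    | none =>
      simp only [msplit_mul_of_ne hq, mmk_some_one]
      exact .refl _
    | some c =>
      obtain rfl := constOf_eq_some.1 hq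
      rw [msplit_mul_const]
      exact (ucEq_mmk_some p c).symm

/-- **Sums of reassembled parts**: `amk x c + amk y c' ≡ amk (amerge x y) (c + c')`. [folklore] -/
theorem ucEq_add_amk : ∀ (x y : Option (PIFormula 𝔽 X)) (c c' : 𝔽),
    UCEq (.add (amk x c) (amk y c')) (amk (amerge x y) (c + c'))
  | none, none, c, c' => (UCEq.const_add (c + c') c c' rfl).symm
  | none, some q, c, c' =>
    (UCEq.add_congr (.refl _) (ucEq_amk_some q c')).trans <|
      (ucEq_const_add_add_const q c c').trans (ucEq_amk_some q (c + c')).symm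
  | some p, none, c, c' =>
    (UCEq.add_congr (ucEq_amk_some p c) (.refl _)).trans <|
      (ucEq_add_const_const p c c').trans (ucEq_amk_some p (c + c')).symm
  | some p, some q, c, c' =>
    (UCEq.add_congr (ucEq_amk_some p c) (ucEq_amk_some q c')).trans <|
      (UCEq.add_add_add_comm p (.const c) q (.const c')).trans <|
        (UCEq.add_congr (.refl _) (UCEq.const_add (c + c') c c' rfl).symm).trans
          (ucEq_amk_some (.add p q) (c + c')).symm

/-- **Products of reassembled parts**: `mmk x c · mmk y c' ≡ mmk (mmerge x y) (c c')`. [folklore] -/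
theorem ucEq_mul_mmk : ∀ (x y : Option (PIFormula 𝔽 X)) (c c' : 𝔽),
    UCEq (.mul (mmk x c) (mmk y c')) (mmk (mmerge x y) (c * c'))
  | none, none, c, c' => (UCEq.const_mul (c * c') c c' rfl).symm
  | none, some q, c, c' =>
    (UCEq.mul_congr (.refl _) (ucEq_mmk_some q c')).trans <|
      (ucEq_const_mul_mul_const q c c').trans (ucEq_mmk_some q (c * c')).symm
  | some p, none, c, c' =>
    (UCEq.mul_congr (ucEq_mmk_some p c) (.refl _)).trans <|
      (ucEq_mul_const_const p c c').trans (ucEq_mmk_some p (c * c')).symm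
  | some p, some q, c, c' =>
    (UCEq.mul_congr (ucEq_mmk_some p c) (ucEq_mmk_some q c')).trans <|
      (UCEq.mul_mul_mul_comm p (.const c) q (.const c')).trans <|
        (UCEq.mul_congr (.refl _) (UCEq.const_mul (c * c') c c' rfl).symm).trans
          (ucEq_mmk_some (.mul p q) (c * c')).symm

/-! ### The smart operations and the normal form are derivable -/

/-- **`F + G ≡ sadd F G`** modulo A1–A5, A7–A10. [folklore] -/
theorem ucEq_sadd (a b : PIFormula 𝔽 X) : UCEq (.add a b) (sadd a b) := by
  rw [sadd_def]
  exact (UCEq.add_congr (ucEq_amk_asplit a) (ucEq_amk_asplit b)).trans (ucEq_add_amk _ _ _ _)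

/-- **`F · G ≡ smul F G`** modulo A1–A5, A7–A10. [folklore] -/
theorem ucEq_smul (a b : PIFormula 𝔽 X) : UCEq (.mul a b) (smul a b) := by
  have e : UCEq (.mul a b) (mmk (mmerge (msplit a).1 (msplit b).1) ((msplit a).2 * (msplit b).2)) :=
    (UCEq.mul_congr (ucEq_mmk_msplit a) (ucEq_mmk_msplit b)).trans (ucEq_mul_mmk _ _ _ _)
  by_cases h : (msplit a).2 * (msplit b).2 = 0
  · rw [smul_of_eq_zero h]
    rw [h] at e
    exact e.trans (ucEq_mmk_zero _)
  · rw [smul_of_ne_zero h]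
    exact e

/-- **Every formula is congruent, modulo everything but distributivity, to its constant-folding
normal form**: `UCEq F (cnorm F)`. [folklore] -/
theorem ucEq_cnorm (F : PIFormula 𝔽 X) : UCEq F (cnorm F) := by
  induction F with
  | var x => exact .refl _
  | const c => exact .refl _
  | add F G ihF ihG =>
    rw [cnorm_add]
    exact (UCEq.add_congr ihF ihG).trans (ucEq_sadd _ _)
  | mul F G ihF ihG =>
    rw [cnorm_mul]
    exact (UCEq.mul_congr ihF ihG).trans (ucEq_smul _ _)

/-! ### Normal forms are fixed by the normaliser -/

/-- The smart sum of the children of a locally normal sum is that sum. [folklore] -/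
theorem sadd_eq_of_localNF {p q : PIFormula 𝔽 X} (h : LocalNF (.add p q)) : sadd p q = .add p q := by
  obtain ⟨hp, hq⟩ := h
  rw [sadd_def, hp.asplit_eq]
  rcases hq with ⟨k, hk, rfl⟩ | hq
  · rw [asplit_const]
    dsimp only
    rw [amerge_some_none, zero_add, amk_some_of_ne p hk]
  · rw [hq.asplit_eq]
    dsimp only
    rw [amerge_some_some, add_zero, amk_some_zero]

/-- The smart product of the children of a locally normal product is that product (over constants
with `0 ≠ 1`). [folklore] -/
theorem smul_eq_of_localNF [Nontrivial 𝔽] {p q : PIFormula 𝔽 X} (h : LocalNF (.mul p q)) :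
    smul p q = .mul p q := by
  obtain ⟨hp, hq⟩ := h
  rcases hq with ⟨k, hk0, hk1, rfl⟩ | hq
  · have h0 : (msplit p).2 * (msplit (.const k : PIFormula 𝔽 X)).2 ≠ 0 := by
      rw [hp.msplit_eq, msplit_const]
      dsimp only
      rwa [one_mul]
    rw [smul_of_ne_zero h0, hp.msplit_eq, msplit_const]
    dsimp only
    rw [mmerge_some_none, one_mul, mmk_some_of_ne p hk1]
  · have h0 : (msplit p).2 * (msplit q).2 ≠ 0 := by
      rw [hp.msplit_eq, hq.msplit_eq]
      dsimp only
      rw [one_mul]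
      exact one_ne_zero
    rw [smul_of_ne_zero h0, hp.msplit_eq, hq.msplit_eq]
    dsimp only
    rw [mmerge_some_some, one_mul, mmk_some_one]

/-- **Normal forms are fixed by the normaliser** (over constants with `0 ≠ 1`): `cnorm a = a` for
`NF a`; in particular `cnorm` is idempotent. [folklore] -/
theorem NF.cnorm_eq [Nontrivial 𝔽] {a : PIFormula 𝔽 X} (h : NF a) : cnorm a = a := by
  induction a with
  | var x => rfl
  | const c => rfl
  | add p q ihp ihq =>
    obtain ⟨h0, hp, hq⟩ := nf_add_iff.1 h
    rw [cnorm_add, ihp hp, ihq hq, sadd_eq_of_localNF h0]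
  | mul p q ihp ihq =>
    obtain ⟨h0, hp, hq⟩ := nf_mul_iff.1 h
    rw [cnorm_mul, ihp hp, ihq hq, smul_eq_of_localNF h0]

/-- The normaliser is idempotent (over constants with `0 ≠ 1`). [folklore] -/
theorem cnorm_cnorm [Nontrivial 𝔽] (F : PIFormula 𝔽 X) : cnorm (cnorm F) = cnorm F :=
  (nf_cnorm F).cnorm_eq

end Semiring

end ACStability

open Literature.Computability.AlgebraicComplexity in
/-- **Every formula is derivably equal, without distributivity, to its constant-folding normal
form** (stub `esat_ucEq_cnorm` of crux `RestorationQP`, line `registered`, rung S3^(1)-inv): over a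
field `𝔽`, the equation `F = cnorm F` is derivable from A1–A5, A7–A10 and R1–R4, i.e.
`UCEq F (cnorm F)`. [folklore] -/
theorem esat_ucEq_cnorm : ∀ {𝔽 : Type} [Field 𝔽] {X : Type} (F : PIFormula 𝔽 X), ACStability.UCEq F (ACStability.cnorm F) := by
  intro _ _ _ F
  exact ACStability.ucEq_cnorm F

end Summit.ValiantsHypothesis.ValiantsHypothesis.Theorems

end
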